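/-
Copyright: the b2b-balaban T⁴-continuum CRUX team, row NE7b leaf lineage `t4-ne7b-formalise-leaf-05` (gen 154). Project licence.
-/
import Mathlib.Analysis.Normed.Group.Basic
import Summits.QuantumFields.BalabanUV.T4Continuum.Spine.NE7b.LinearisedLatticeStokes

/-!
# THE LINEARISED LATTICE NON-ABELIAN STOKES IDENTITY WITH CURVATURE DEFECT, II — the coordinate rectangle: at FLAT background the `N`-part
# of the boundary pair holonomy is EXACTLY the product of the transported linearised plaquette holonomies; with curvature the same up to a
# defect `≤ c · Σ_rows (row curvature) · (row size budget)`; the additive dictionary `N = Multiplicative V`, `sz = ‖·‖`; gauge covariance of the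
# linearised holonomy (the `Ad` model of the defect letter, `c = 2`, is the tree's `BlockAverageLoopLogCore.norm_units_conj_sub_self_le` — not restated)
# (row NE7b, node U5c; `SectE-interface-proof.md` Lemma CS (i); part I = `LinearisedLatticeStokes`)

Cell `pub-balaban`, sub-cell `t4`, spine estimate NE7b (`T4WeightBudget.RelWeightBound`; the cell's OWN estimate — NOT PRINTED in
[Bałaban 1983–89], NOT PROVED).  Crux-route work under `Spine/NE7b/` by a row leaf; [folklore] lattice gauge algebra on ONE configuration;
NOTHING of Bałaban's is named, asserted or valued; no `T4Continuum/Support` leaf typed; no `def`; zero `sorry`.  Imports: Mathlib + part I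
(hence `NonAbelianStokesBound`'s `rectWord ∕ hol_rectWord_succ ∕ hol_rectWord_zero ∕ dist1_hol_rectWord_le_sum ∕ dist1_hol_ladder_seg_le_sum` and
`B7Prop1Explicit`'s `hol_gaugeAct` BY NAME).

WHAT IS PROVED ([folklore]; notation of part I: pair configuration `W = ⟨A, U⟩ : bonds → N ⋊[φ] G`, `hU : W.right = U`):
* §5 THE COORDINATE RECTANGLE (`n × K` plaquettes `p_{ij} = ∂p_{κμ}(x + ie_κ + je_μ)`, transports `T_{ij} = U([x, x+je_μ]) U([x+je_μ,
  x+je_μ+ie_κ])`): `hol_rectWord_eq_one_of_flat` (group level), `prod_row_transport`; **`left_hol_rectWord_of_flat`** — THE LINEARISED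
  NON-ABELIAN STOKES THEOREM AT FLAT BACKGROUND: `(∂R).left = ∏_{j<K} ∏_{i<n} φ(T_{ij}) p_{ij}.left` (for `N = Multiplicative 𝔤`, `φ = Ad`:
  «covariant boundary sum of `A` = surface sum of transported covariant curls», the memo's (i) — exact ONLY at flat `U`);
  `rect_quotient_succ`; **`sz_rectWord_defect_le`** — under part I's size letters (`c ≥ 0`), with curvature: against the comparison formula whose
  transports are `r_j · U([x,x+je_μ]) · U([x_j,x_j+ie_κ])` (`r_j = U(∂R_{n,j})` the sub-rectangle holonomy, a closed-loop transport, `= 1` when flat —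
  kept on purpose: re-basing it to `1` costs sub-rectangle curvature × `O(1)` sizes, not small for `L^k` rows, while a Jensen ∕ Cauchy–Schwarz consumer
  only needs `φ`-isometries) the defect has size `≤ c · Σ_j S_j · B_j`, `S_j` = curvature of ROW `j`, `B_j = sz t_j + Σ_i (sz A(x_j+ie_κ,κ) + sz p_{ij}.left)`
  — every remaining defect is a conjugation by a sub-ladder holonomy of the same row (`dist1_hol_ladder_seg_le_sum` BY NAME); `sz_transport_quotient_le`
  (step (ii)'s letter: two transports of one form differ by `≤ c · dist1(loop between them) · sz`).
* §6 THE ADDITIVE DICTIONARY `sz_letters_of_norm`: for `N = Multiplicative V` (`V` seminormed additive commutative), `sz = ‖toAdd ·‖`, the five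
  size letters ARE «seminorm» + «`φ` isometric» + «`‖φ(g)v − v‖ ≤ c · dist1 g · ‖v‖`»; **`norm_rectWord_sub_sum_le`** — THE END IN NORMED LETTERS:
  `‖(∂R).left − Σ_{ij} φ(T_{ij}) p_{ij}.left‖ ≤ c · Σ_j S_j B_j` from the two additive letters.  THE MODEL for `Ad` on the units `u ∈ B7Prop1Explicit.U1 𝔸` of a
  normed ring is already in the tree and NOT restated (the gate's `dedup.landed` on this file's v1.4, p381058): `T4TermwiseBCH.norm_units_conj_eq`
  (`‖uXu⁻¹‖ = ‖X‖`) and `BlockAverageLoopLogCore.norm_units_conj_sub_self_le` (`‖uXu⁻¹ − X‖ ≤ 2‖u − 1‖‖X‖`, i.e. `c = 2`); the cell's `U(n)` ∕ `SU(n)`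
  instances with the operator norm: `Spine/NE7b/LinearisedLatticeStokesUnitary`.
* §7 GAUGE COVARIANCE: a pure-`G` gauge transformation `inr ∘ u` acts by `A(b) ↦ φ(u(b₋))A(b)` (`left_gaugeAct_inr`), `U ↦ U^u` (`right_gaugeAct_inr`),
  and **`left_hol_gaugeAct_inr`**: `(hol W^u x w).left = φ(u x)(hol W x w).left` for EVERY word — the linearised holonomy is gauge covariant
  (`B7Prop1Explicit.hol_gaugeAct` read in `N`); the structural fact behind the (iso)∕(cov) letters of `AdmissibleFloorIMS` ∕ `GaugeCovarianceLetters`.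

NOT HERE (honest): general discs (the scripts of `NonAbelianStokesDisc` apply verbatim to pairs — not restated); the comparison average `M_k`,
(R-M), (R-V), the counting and Jensen ∕ Cauchy–Schwarz of (5.2) (`Spine/NE7b/CovariantStokesCounting`), any value of `ε_F`, `c_g` — WHICH configuration,
rectangle and 1-form are Bałaban's ((A3) ∕ (A1c), NC-NE7b-α UNRULED).  BY-NAME EFFECT ON THE WALL:
NONE.  NE7b NOT PRINTED ∕ NOT PROVED; spine PROVED 0∕9; rung (B)+1 on a FINITE torus — NOT infinite volume, NOT the mass gap, NOT Clay.
HONEST DEPENDENCY: continuum YM on T⁴ ⇐ BetaPertH ∧ nine spine estimates (0/9 proved); BetaPertH ⇐ (D1) ∧ (D4) ∧ CAP+tail; G-an2-4 gates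
asym, D1 and NE2/3/4.
-/

set_option autoImplicit false

open scoped BigOperators

namespace Summit.QuantumFields.BalabanUV.T4Continuum.NE7b.LinearisedLatticeStokesRectangle

open Literature.MathematicalPhysics.QuantumFieldTheory.Balaban1983to89 (GaugeGroup dist1)
open Literature.MathematicalPhysics.QuantumFieldTheory.Balaban1983to89.B7Prop1Explicit
  (Site Letter e disp hol seg plaqWord ladder)
open NonAbelianStokesBound (rectWord hol_rectWord_succ hol_rectWord_zero dist1_hol_ladder_seg_le_sum dist1_hol_rectWord_le_sum)
open LinearisedLatticeStokes

variable {d : ℕ}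

/-! ## §5 The coordinate rectangle: `n × K` plaquettes, a stack of `K` ladders (`NonAbelianStokesBound.hol_rectWord_succ`) -/

section Rectangle

variable {G : Type*} [Group G]

/-- **GROUP-LEVEL FLATNESS OF THE RECTANGLE**: trivial plaquette holonomies ⟹ trivial rectangle holonomy. [folklore] -/
theorem hol_rectWord_eq_one_of_flat (V : Site d → Fin d → G) (x : Site d) (κ μ : Fin d) (n : ℕ) :
    ∀ K : ℕ, (∀ i j : ℕ, i < n → j < K → hol V (x + (i : ℤ) • e κ + (j : ℤ) • e μ) (plaqWord κ μ) = 1) →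
      hol V x (rectWord κ μ n K) = 1
  | 0, _ => hol_rectWord_zero V x κ μ n
  | K + 1, h => by
    have hK : ∀ i j : ℕ, i < n → j < K → hol V (x + (i : ℤ) • e κ + (j : ℤ) • e μ) (plaqWord κ μ) = 1 :=
      fun i j hi hj => h i j hi (Nat.lt_succ_of_lt hj)
    have hlad : ∀ i : ℕ, i < n → hol V (x + (K : ℤ) • e μ + (i : ℤ) • e κ) (plaqWord κ μ) = 1 := fun i hi => by
      rw [show x + (K : ℤ) • e μ + (i : ℤ) • e κ = x + (i : ℤ) • e κ + (K : ℤ) • e μ by abel]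
      exact h i K hi (Nat.lt_succ_self K)
    rw [hol_rectWord_succ, hol_rectWord_eq_one_of_flat V x κ μ n K hK,
      hol_ladder_seg_eq_one_of_flat V κ μ n _ hlad, mul_one, mul_inv_cancel, mul_one]

variable {N : Type*} [CommGroup N] {φ : G →* MulAut N}
variable (W : Site d → Fin d → N ⋊[φ] G) (U : Site d → Fin d → G)

/-- Merging the row transport into the flat ladder formula: `∏_i φ(τ · T_i(x_j)) p_{ij}.left = φ(τ) (∏_i φ(T_i(x_j)) p_{ij}.left)`. [folklore] -/
theorem prod_row_transport (x : Site d) (κ μ : Fin d) (n : ℕ) (j : ℕ) (τ : G) :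
    ∏ i ∈ Finset.range n, φ (τ * hol U (x + (j : ℤ) • e μ) (seg κ (i : ℤ)))
        (hol W (x + (i : ℤ) • e κ + (j : ℤ) • e μ) (plaqWord κ μ)).left =
      φ τ (∏ i ∈ Finset.range n, φ (hol U (x + (j : ℤ) • e μ) (seg κ (i : ℤ)))
        (hol W (x + (j : ℤ) • e μ + (i : ℤ) • e κ) (plaqWord κ μ)).left) := by
  rw [map_prod]
  refine Finset.prod_congr rfl fun i _ => ?_
  rw [aut_aut, show x + (j : ℤ) • e μ + (i : ℤ) • e κ = x + (i : ℤ) • e κ + (j : ℤ) • e μ by abel]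

/-- **THE LINEARISED NON-ABELIAN STOKES THEOREM AT FLAT BACKGROUND (coordinate rectangle).**  If every plaquette of the `n × K` rectangle
based at `x` in the `(κ, μ)`-plane has trivial transport, the `N`-part of the pair holonomy of its boundary word is EXACTLY the product over the
plaquettes of the linearised plaquette holonomies transported to `x` along «up `j e_μ`, then right `i e_κ`»:
`(∂R).left = ∏_{j<K} ∏_{i<n} φ(U([x, x+je_μ]) U([x+je_μ, x+je_μ+ie_κ])) (∂p_{κμ}(x+ie_κ+je_μ)).left`.
For `N = Multiplicative 𝔤`, `φ = Ad` this is «boundary covariant sum of `A` = surface sum of transported covariant curls». [folklore] -/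
theorem left_hol_rectWord_of_flat (hU : ∀ y k, (W y k).right = U y k) (x : Site d) (κ μ : Fin d) (n : ℕ) :
    ∀ K : ℕ, (∀ i j : ℕ, i < n → j < K → hol U (x + (i : ℤ) • e κ + (j : ℤ) • e μ) (plaqWord κ μ) = 1) →
      (hol W x (rectWord κ μ n K)).left =
        ∏ j ∈ Finset.range K, ∏ i ∈ Finset.range n,
          φ (hol U x (seg μ (j : ℤ)) * hol U (x + (j : ℤ) • e μ) (seg κ (i : ℤ)))
            (hol W (x + (i : ℤ) • e κ + (j : ℤ) • e μ) (plaqWord κ μ)).left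
  | 0, _ => by rw [hol_rectWord_zero, Finset.prod_range_zero, SemidirectProduct.one_left]
  | K + 1, h => by
    have hK : ∀ i j : ℕ, i < n → j < K → hol U (x + (i : ℤ) • e κ + (j : ℤ) • e μ) (plaqWord κ μ) = 1 :=
      fun i j hi hj => h i j hi (Nat.lt_succ_of_lt hj)
    have hlad : ∀ i : ℕ, i < n → hol U (x + (K : ℤ) • e μ + (i : ℤ) • e κ) (plaqWord κ μ) = 1 := fun i hi => by
      rw [show x + (K : ℤ) • e μ + (i : ℤ) • e κ = x + (i : ℤ) • e κ + (K : ℤ) • e μ by abel]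
      exact h i K hi (Nat.lt_succ_self K)
    have ih := left_hol_rectWord_of_flat hU x κ μ n K hK
    have hR : hol U x (rectWord κ μ n K) = 1 := hol_rectWord_eq_one_of_flat U x κ μ n K hK
    have hH : hol U (x + (K : ℤ) • e μ) (ladder (seg κ (n : ℤ)) μ) = 1 := hol_ladder_seg_eq_one_of_flat U κ μ n _ hlad
    have hL := left_hol_ladder_seg_of_flat W U hU κ μ n (x + (K : ℤ) • e μ) hlad
    rw [hol_rectWord_succ, SemidirectProduct.mul_left, right_hol W U hU, hR, map_one, MulAut.one_apply, ih, left_conj,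
      right_conj, right_hol W U hU, right_hol W U hU, hH, mul_one, mul_inv_cancel, map_one, MulAut.one_apply,
      mul_inv_cancel_comm, hL, Finset.prod_range_succ, prod_row_transport]

end Rectangle

section RectangleSizes

variable {G N : Type*} [GaugeGroup G] [CommGroup N] {φ : G →* MulAut N}
variable (W : Site d → Fin d → N ⋊[φ] G) (U : Site d → Fin d → G)

/-- The algebra of one rectangle step against the comparison formula (commutative `N`). [folklore] -/
theorem rect_quotient_succ (R F t L Fl : N) (r τ k : G) :
    R * φ r (t * φ τ L * (φ k t)⁻¹) * (F * φ r (φ τ Fl))⁻¹ = R * F⁻¹ * φ r ((φ k t * t⁻¹)⁻¹ * φ τ (L * Fl⁻¹)) := by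
  simp only [map_mul, map_inv]
  apply Additive.ofMul.injective
  simp only [ofMul_mul, ofMul_inv]
  abel

/-- **THE LINEARISED NON-ABELIAN STOKES ESTIMATE FOR THE COORDINATE RECTANGLE WITH CURVATURE.**  Under the size letters of part I (`c ≥ 0`), the
`N`-part of the boundary pair holonomy of the `n × K` rectangle equals — up to an element of size
`≤ c · Σ_{j<K} S_j · (sz t_j + Σ_{i<n} (sz A(x_j+ie_κ, κ) + sz (∂p(x_j+ie_κ)).left))` — the product over the plaquettes of their linearised holonomies
transported by `r_j · U([x, x+je_μ]) · U([x_j, x_j+ie_κ])`, where `x_j = x + je_μ`, `S_j = Σ_{i<n} dist1 U(∂p_{κμ}(x_j+ie_κ))` is the curvature of ROW `j`,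
`t_j` the `N`-part of the side transport `[x, x+je_μ]`, and `r_j = U(∂R_{n,j})` is the holonomy of the SUB-RECTANGLE below row `j` — a closed-loop
transport (`= 1` at flat background, `left_hol_rectWord_of_flat`), kept in the formula ON PURPOSE: re-basing it to `1` would cost `dist1 r_j × O(sz L_j)`
per row (the sub-rectangle's total curvature against an `O(1)` size), which is NOT small in the regime of (5.2) (`n = L^k` rows), whereas a consumer that
applies Jensen ∕ Cauchy–Schwarz to the transported sum only needs the transports to be `φ`-isometries.  Every defect that remains is a conjugation by a
SUB-LADDER holonomy of the same row, priced by `dist1_hol_ladder_seg_le_sum` BY NAME (the rectangle recursion `hol_rectWord_succ` itself is exact in `N`).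
[folklore] -/
theorem sz_rectWord_defect_le (hU : ∀ y k, (W y k).right = U y k) (sz : N → ℝ) {c : ℝ} (hc : 0 ≤ c) (h0 : ∀ a, 0 ≤ sz a)
    (hmul : ∀ a b, sz (a * b) ≤ sz a + sz b) (hinv : ∀ a, sz a⁻¹ = sz a) (hiso : ∀ (g : G) (a : N), sz (φ g a) = sz a)
    (hdef : ∀ (g : G) (a : N), sz (φ g a * a⁻¹) ≤ c * dist1 g * sz a) (x : Site d) (κ μ : Fin d) (n : ℕ) :
    ∀ K : ℕ,
      sz ((hol W x (rectWord κ μ n K)).left *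
          (∏ j ∈ Finset.range K, ∏ i ∈ Finset.range n,
            φ (hol U x (rectWord κ μ n j) * hol U x (seg μ (j : ℤ)) * hol U (x + (j : ℤ) • e μ) (seg κ (i : ℤ)))
              (hol W (x + (i : ℤ) • e κ + (j : ℤ) • e μ) (plaqWord κ μ)).left)⁻¹)
        ≤ c * ∑ j ∈ Finset.range K,
              (∑ i ∈ Finset.range n, dist1 (hol U (x + (j : ℤ) • e μ + (i : ℤ) • e κ) (plaqWord κ μ))) *
                (sz (hol W x (seg μ (j : ℤ))).left +
                  ∑ i ∈ Finset.range n, (sz (W (x + (j : ℤ) • e μ + (i : ℤ) • e κ) κ).left +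
                    sz (hol W (x + (j : ℤ) • e μ + (i : ℤ) • e κ) (plaqWord κ μ)).left))
  | 0 => by
    rw [hol_rectWord_zero, Finset.prod_range_zero, Finset.sum_range_zero, SemidirectProduct.one_left, inv_one, mul_one,
      sz_one_eq_zero sz h0 hdef]
    simp
  | K + 1 => by
    have ih := sz_rectWord_defect_le hU sz hc h0 hmul hinv hiso hdef x κ μ n K
    have hlad := sz_ladder_defect_le W U hU sz hc h0 hmul hinv hiso hdef κ μ n (x + (K : ℤ) • e μ)
    set Srow := ∑ i ∈ Finset.range n, dist1 (hol U (x + (K : ℤ) • e μ + (i : ℤ) • e κ) (plaqWord κ μ)) with hSrow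
    set Blad := ∑ i ∈ Finset.range n, (sz (W (x + (K : ℤ) • e μ + (i : ℤ) • e κ) κ).left +
      sz (hol W (x + (K : ℤ) • e μ + (i : ℤ) • e κ) (plaqWord κ μ)).left) with hBlad
    set r := hol U x (rectWord κ μ n K) with hr
    set τ := hol U x (seg μ (K : ℤ)) with hτ
    set H := hol U (x + (K : ℤ) • e μ) (ladder (seg κ (n : ℤ)) μ) with hH
    have hSrow0 : 0 ≤ Srow := Finset.sum_nonneg fun i _ => GaugeGroup.dist1_nonneg _
    have hkS : dist1 (τ * H * τ⁻¹) ≤ Srow :=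
      (le_of_eq (GaugeGroup.dist1_conj _ _)).trans (dist1_hol_ladder_seg_le_sum U κ μ n _)
    have hF : ∏ i ∈ Finset.range n, φ (r * τ * hol U (x + (K : ℤ) • e μ) (seg κ (i : ℤ)))
          (hol W (x + (i : ℤ) • e κ + (K : ℤ) • e μ) (plaqWord κ μ)).left =
        φ r (φ τ (∏ i ∈ Finset.range n, φ (hol U (x + (K : ℤ) • e μ) (seg κ (i : ℤ)))
          (hol W (x + (K : ℤ) • e μ + (i : ℤ) • e κ) (plaqWord κ μ)).left)) := by
      rw [prod_row_transport, aut_aut]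
    rw [hol_rectWord_succ, SemidirectProduct.mul_left, right_hol W U hU, ← hr, left_conj, right_conj, right_hol W U hU,
      right_hol W U hU, ← hτ, ← hH, Finset.prod_range_succ, hF, Finset.sum_range_succ, mul_add, rect_quotient_succ]
    set k := τ * H * τ⁻¹
    set t := (hol W x (seg μ (K : ℤ))).left
    set L := (hol W (x + (K : ℤ) • e μ) (ladder (seg κ (n : ℤ)) μ)).left
    set R := (hol W x (rectWord κ μ n K)).left
    set F := ∏ j ∈ Finset.range K, ∏ i ∈ Finset.range n,
      φ (hol U x (rectWord κ μ n j) * hol U x (seg μ (j : ℤ)) * hol U (x + (j : ℤ) • e μ) (seg κ (i : ℤ)))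
        (hol W (x + (i : ℤ) • e κ + (j : ℤ) • e μ) (plaqWord κ μ)).left
    set Fl := ∏ i ∈ Finset.range n, φ (hol U (x + (K : ℤ) • e μ) (seg κ (i : ℤ)))
      (hol W (x + (K : ℤ) • e μ + (i : ℤ) • e κ) (plaqWord κ μ)).left
    calc sz (R * F⁻¹ * φ r ((φ k t * t⁻¹)⁻¹ * φ τ (L * Fl⁻¹)))
        ≤ sz (R * F⁻¹) + sz (φ r ((φ k t * t⁻¹)⁻¹ * φ τ (L * Fl⁻¹))) := hmul _ _
      _ ≤ sz (R * F⁻¹) + (sz (φ k t * t⁻¹)⁻¹ + sz (φ τ (L * Fl⁻¹))) := by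
          rw [hiso]; exact add_le_add le_rfl (hmul _ _)
      _ ≤ c * (∑ j ∈ Finset.range K,
              (∑ i ∈ Finset.range n, dist1 (hol U (x + (j : ℤ) • e μ + (i : ℤ) • e κ) (plaqWord κ μ))) *
                (sz (hol W x (seg μ (j : ℤ))).left +
                  ∑ i ∈ Finset.range n, (sz (W (x + (j : ℤ) • e μ + (i : ℤ) • e κ) κ).left +
                    sz (hol W (x + (j : ℤ) • e μ + (i : ℤ) • e κ) (plaqWord κ μ)).left))) +
            (c * dist1 k * sz t + c * Srow * Blad) := by
          rw [hinv, hiso]; exact add_le_add ih (add_le_add (hdef k t) hlad)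
      _ ≤ c * (∑ j ∈ Finset.range K,
              (∑ i ∈ Finset.range n, dist1 (hol U (x + (j : ℤ) • e μ + (i : ℤ) • e κ) (plaqWord κ μ))) *
                (sz (hol W x (seg μ (j : ℤ))).left +
                  ∑ i ∈ Finset.range n, (sz (W (x + (j : ℤ) • e μ + (i : ℤ) • e κ) κ).left +
                    sz (hol W (x + (j : ℤ) • e μ + (i : ℤ) • e κ) (plaqWord κ μ)).left))) +
            (c * Srow * sz t + c * Srow * Blad) := by
          have h3 : c * dist1 k * sz t ≤ c * Srow * sz t :=
            mul_le_mul_of_nonneg_right (mul_le_mul_of_nonneg_left hkS hc) (h0 _)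
          linarith
      _ = _ := by ring

/-- **LEMMA CS (ii)'s LETTER — TWO TRANSPORTS OF THE SAME FORM DIFFER BY THE DEFECT OF THE LOOP BETWEEN THEM**:
`sz(φ(g₁)a · (φ(g₂)a)⁻¹) ≤ c · dist1(g₂⁻¹g₁) · sz a`.  With `g₁ = U(γ₁)`, `g₂ = U(γ₂)` the transports along two lattice paths from the base point to the
same bond, `g₂⁻¹g₁ = U(γ₂⁻¹γ₁)` is a closed-loop holonomy, priced per plaquette by the GROUP-level Stokes sums (`NonAbelianStokesBound.dist1_hol_rectWord_le_sum`,
`NonAbelianStokesDisc.dist1_hol_build_le_sum`) — the algebra of the memo's step (ii) («the two transports connect the same endpoints by fine paths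
enclosing `O(d)L^{2k}` fine plaquettes, each with `|U(∂p) − 1| ≤ ε_Fη²`»). [folklore] -/
theorem sz_transport_quotient_le (sz : N → ℝ) {c : ℝ} (hiso : ∀ (g : G) (a : N), sz (φ g a) = sz a)
    (hdef : ∀ (g : G) (a : N), sz (φ g a * a⁻¹) ≤ c * dist1 g * sz a) (g₁ g₂ : G) (a : N) :
    sz (φ g₁ a * (φ g₂ a)⁻¹) ≤ c * dist1 (g₂⁻¹ * g₁) * sz a := by
  have e1 : φ g₁ a * (φ g₂ a)⁻¹ = φ g₂ (φ (g₂⁻¹ * g₁) a * a⁻¹) := by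
    rw [map_mul (φ g₂), aut_aut, mul_inv_cancel_left, map_inv (φ g₂) a]
  rw [e1, hiso]
  exact hdef _ _

end RectangleSizes

/-! ## §6 The additive dictionary (`N = Multiplicative V`) and the model of the defect letter for `Ad` -/

section Additive

variable {G : Type*} [GaugeGroup G] {V : Type*} [SeminormedAddCommGroup V] (φ : G →* MulAut (Multiplicative V))

/-- **THE SIZE LETTERS ARE THE TWO ADDITIVE LETTERS.**  For `N = Multiplicative V` and `sz a = ‖toAdd a‖`, subadditivity, inversion
invariance and nonnegativity are the seminorm axioms, and the isometry ∕ conjugation-defect letters are VERBATIM «`‖φ(g)v‖ = ‖v‖`» and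
«`‖φ(g)v − v‖ ≤ c · dist1 g · ‖v‖`» (for `φ = Ad` of a gauge group on `𝔤`: `c = 2`, the tree's `BlockAverageLoopLogCore.norm_units_conj_sub_self_le` ∕
`LinearisedLatticeStokesUnitary.sz_letters_unitaryAd`).  The quotient of §4–§5
reads `‖(∂R).left − Σ_{ij} φ(T_{ij}) p_{ij}.left‖` (`toAdd_mul`, `toAdd_inv`). [folklore] -/
theorem sz_letters_of_norm {c : ℝ}
    (hiso : ∀ (g : G) (a : Multiplicative V), ‖(φ g a).toAdd‖ = ‖a.toAdd‖)
    (hdef : ∀ (g : G) (a : Multiplicative V), ‖(φ g a).toAdd - a.toAdd‖ ≤ c * dist1 g * ‖a.toAdd‖) :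
    (∀ a : Multiplicative V, 0 ≤ ‖a.toAdd‖) ∧
    (∀ a b : Multiplicative V, ‖(a * b).toAdd‖ ≤ ‖a.toAdd‖ + ‖b.toAdd‖) ∧
    (∀ a : Multiplicative V, ‖a⁻¹.toAdd‖ = ‖a.toAdd‖) ∧
    (∀ (g : G) (a : Multiplicative V), ‖(φ g a).toAdd‖ = ‖a.toAdd‖) ∧
    (∀ (g : G) (a : Multiplicative V), ‖(φ g a * a⁻¹).toAdd‖ ≤ c * dist1 g * ‖a.toAdd‖) := by
  refine ⟨fun a => norm_nonneg _, fun a b => ?_, fun a => ?_, hiso, fun g a => ?_⟩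
  · rw [toAdd_mul]; exact norm_add_le _ _
  · rw [toAdd_inv, norm_neg]
  · rw [toAdd_mul, toAdd_inv, ← sub_eq_add_neg]; exact hdef g a

variable {d : ℕ} (W : Site d → Fin d → Multiplicative V ⋊[φ] G) (U : Site d → Fin d → G)

/-- **THE END IN NORMED LETTERS.**  For `N = Multiplicative V` the rectangle estimate `sz_rectWord_defect_le` reads, with `toAdd` distributing over
the products (`toAdd_prod`): `‖(∂R).left − Σ_{j<K} Σ_{i<n} φ(T_{ij}) p_{ij}.left‖ ≤ c · Σ_j S_j · B_j`, `T_{ij} = r_j · U([x,x+je_μ]) · U([x_j,x_j+ie_κ])` — the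
covariant boundary sum of the 1-form equals the sum of the transported linearised plaquette holonomies up to `c × Σ_rows (row curvature × row budget)`,
from the two additive letters alone. [folklore] -/
theorem norm_rectWord_sub_sum_le (hU : ∀ y k, (W y k).right = U y k) {c : ℝ} (hc : 0 ≤ c)
    (hiso : ∀ (g : G) (a : Multiplicative V), ‖(φ g a).toAdd‖ = ‖a.toAdd‖)
    (hdef : ∀ (g : G) (a : Multiplicative V), ‖(φ g a).toAdd - a.toAdd‖ ≤ c * dist1 g * ‖a.toAdd‖)
    (x : Site d) (κ μ : Fin d) (n K : ℕ) :
    ‖((hol W x (rectWord κ μ n K)).left).toAdd -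
        ∑ j ∈ Finset.range K, ∑ i ∈ Finset.range n,
          (φ (hol U x (rectWord κ μ n j) * hol U x (seg μ (j : ℤ)) * hol U (x + (j : ℤ) • e μ) (seg κ (i : ℤ)))
            (hol W (x + (i : ℤ) • e κ + (j : ℤ) • e μ) (plaqWord κ μ)).left).toAdd‖
      ≤ c * ∑ j ∈ Finset.range K,
            (∑ i ∈ Finset.range n, dist1 (hol U (x + (j : ℤ) • e μ + (i : ℤ) • e κ) (plaqWord κ μ))) *
              (‖((hol W x (seg μ (j : ℤ))).left).toAdd‖ +
                ∑ i ∈ Finset.range n, (‖((W (x + (j : ℤ) • e μ + (i : ℤ) • e κ) κ).left).toAdd‖ +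
                  ‖((hol W (x + (j : ℤ) • e μ + (i : ℤ) • e κ) (plaqWord κ μ)).left).toAdd‖)) := by
  obtain ⟨h0, hmul, hinv, hiso', hdef'⟩ := sz_letters_of_norm φ hiso hdef
  have h := LinearisedLatticeStokesRectangle.sz_rectWord_defect_le W U hU (fun a => ‖a.toAdd‖) hc h0 hmul hinv hiso'
    hdef' x κ μ n K
  simp only [toAdd_mul, toAdd_inv, toAdd_prod, ← sub_eq_add_neg] at h
  exact h

end Additive

/-! The MODEL of the two additive letters for `φ = Ad` on the units `u ∈ U1 𝔸` of a normed ring (`‖u‖, ‖u⁻¹‖ ≤ 1`) is ALREADY in the tree and is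
not restated here: the isometry `‖uXu⁻¹‖ = ‖X‖` is `Literature.….Balaban1983to89.T4TermwiseBCH.norm_units_conj_eq`, the conjugation defect
`‖uXu⁻¹ − X‖ ≤ 2‖u − 1‖‖X‖` (i.e. `c = 2` with `dist1 u = ‖u − 1‖`) is `Summit.….T4Continuum.BlockAverageLoopLogCore.norm_units_conj_sub_self_le`;
the cell's `U(n)` ∕ `SU(n)` instances are served by the sibling `Spine/NE7b/LinearisedLatticeStokesUnitary`. -/

/-! ## §7 Gauge covariance of the linearised holonomy: a pure-`G` gauge transformation acts on the `N`-part by `φ(u(base))` -/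

section GaugeCovariance

open Literature.MathematicalPhysics.QuantumFieldTheory.Balaban1983to89.B7Prop1Explicit (gaugeAct hol_gaugeAct)

variable {G N : Type*} [Group G] [Group N] {φ : G →* MulAut N}
variable (W : Site d → Fin d → N ⋊[φ] G) (U : Site d → Fin d → G)

/-- A gauge transformation `u : sites → G`, embedded as `inr ∘ u`, acts on a pair configuration bondwise by `A(b) ↦ φ(u(b₋)) A(b)` on the `N`-part
([B9] (3.29)'s pattern `B^u(b) = Ad(u(b₋))B(b)`, here for any `φ`) … [folklore] -/
theorem left_gaugeAct_inr (u : Site d → G) (x : Site d) (μ : Fin d) :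
    (gaugeAct (fun y => (SemidirectProduct.inr (u y) : N ⋊[φ] G)) W x μ).left = φ (u x) (W x μ).left := by
  simp only [gaugeAct, SemidirectProduct.mul_left, SemidirectProduct.inv_left, SemidirectProduct.left_inr,
    SemidirectProduct.right_inr, SemidirectProduct.mul_right, one_mul, inv_one, map_one, mul_one]

/-- … and by the usual `U(b) ↦ u(b₋)U(b)u(b₊)⁻¹` on the `G`-part (`B7Prop1Explicit.gaugeAct`). [folklore] -/
theorem right_gaugeAct_inr (hU : ∀ y k, (W y k).right = U y k) (u : Site d → G) (x : Site d) (μ : Fin d) :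
    (gaugeAct (fun y => (SemidirectProduct.inr (u y) : N ⋊[φ] G)) W x μ).right = gaugeAct u U x μ := by
  simp only [gaugeAct, SemidirectProduct.mul_right, SemidirectProduct.inv_right, SemidirectProduct.right_inr, hU]

/-- **THE LINEARISED HOLONOMY IS GAUGE COVARIANT**: along ANY word the `N`-part of the gauge-transformed pair holonomy is `φ(u(x))` of the old one —
`(hol W^u x w).left = φ(u x) (hol W x w).left` (`hol_gaugeAct` read in `N`; the end-point factor `u(x + disp w)⁻¹` has trivial `N`-part).  So every
boundary sum ∕ covariant curl of this file and of part I is an ISOMETRIC image of its gauge transform once `φ` is `sz`-isometric — the structural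
fact behind the (iso)∕(cov) letters of `AdmissibleFloorIMS` ∕ `GaugeCovarianceLetters`. [folklore] -/
theorem left_hol_gaugeAct_inr (u : Site d → G) (x : Site d) (w : List (Letter d)) :
    (hol (gaugeAct (fun y => (SemidirectProduct.inr (u y) : N ⋊[φ] G)) W) x w).left = φ (u x) (hol W x w).left := by
  rw [hol_gaugeAct]
  simp only [SemidirectProduct.mul_left, SemidirectProduct.inv_left, SemidirectProduct.left_inr,
    SemidirectProduct.right_inr, SemidirectProduct.mul_right, one_mul, inv_one, map_one, mul_one]

end GaugeCovariance

end Summit.QuantumFields.BalabanUV.T4Continuum.NE7b.LinearisedLatticeStokesRectangle
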